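import Mathlib
import HarnessLib

/-!
# QUANT lane R8, front "FAR beyond trees", layer one — the DECOUPLING-CHAIN TOOLKIT (law level): composing dominations,
# independent noise, and the first-coordinate-tight criterion with its `q`-affine reduction

builds on p205010 (kernel theorem, internal audit signed; external expert review pending)

Support file (`--supports stmt-CriticalPhenomena-4575`), seat `prim-quant-p1` (gen 20); memo
`run/shared/lean/prim/quant/prim-quant-p1-g20/FOR-LEAD-KANCHOR.md` §2.  Pure real algebra; standard axioms; no sorries; no definitions.

The block-transfer theorem (`Block.real_card_le_one_le_of_dominates`, file K3 of p1 g19) asks that the internal numbers `S = (h_S, t_S)` of a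
pendant block DOMINATE a convex combination of the comparison block's numbers `S' = (h', t')` and the exit point `Q = (q, q)`:
`∃ λ ∈ [0,1], λh' + (1−λ)q ≤ h_S ∧ λt' + (1−λ)q ≤ t_S`.  For blocks loaded at `k ≥ 3` vertices the comparison block (the fully decoupled
block: independent stems at the cut vertex) is reached through a CHAIN of intermediate laws (one-vertex decouplings, series reductions,
independent noise); this file supplies the bookkeeping so that only the one-step inequalities remain to be proved:

* `Block.dominates_trans` — domination is transitive with the same exit point (`λ = λ₁λ₂`);
* `Block.dominates_of_exit` / `Block.dominates_of_le` — the two trivial instances `λ = 0` (exit: `q ≤ h_S`, `q ≤ t_S`) and `λ = 1`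
  (componentwise `S' ≤ S`);
* `Block.dominates_noise` — adding an INDEPENDENT count `W₀` (law `z₀, s₀, d₀` on `{0, 1, ≥2}`) to both blocks maps `(h, t) ↦ (z₀h + (1−z₀), z₀t + s₀h + d₀)`;
  this affine monotone map fixes the property "dominates a mixture of `·` and `Q`" whenever `q ≤ 1` (the image of `Q` lies above `Q`);
* `Block.dominates_of_tight` — the FIRST-COORDINATE-TIGHT criterion: if `q ≤ h_S ≤ h'`, `q < h'` and
  `F := (t_S − t')(h' − q) − (h' − h_S)(q − t') ≥ 0` then `S` dominates a mixture of `S'` and `Q` (`λ = (h_S − q)/(h' − q)`); the identity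
  `F = (t_S − q)(h' − q) + (h_S − q)(q − t')` makes the second coordinate exactly `F ≥ 0`;
* `Block.tight_F_affine` — `F` is affine in `q` with `F(t_S) = (t_S − t')(h_S − t_S)`, so `D := t_S − t' ≥ 0`, `t_S ≤ h_S` and `F(μ) ≥ 0` give
  `F(q) ≥ 0` for every `q ∈ [t_S, μ]` — the reduction of the k-anchor inequality to its value at `q = μ = min_i m_i u_i` (memo §2, F2).
[this work]
-/

namespace Summit.CriticalPhenomena.PercolationContinuityZ3.Theorems

namespace Quant

namespace Block

/-- **Transitivity of domination (same exit point).**  If `S` dominates a mixture of `S₁` and `Q` and `S₁` dominates a mixture of `S₂` and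
`Q`, then `S` dominates a mixture of `S₂` and `Q` (take `λ = λ₁λ₂`). [this work] -/
theorem dominates_trans (q hS tS h₁ t₁ h₂ t₂ : ℝ)
    (H₁ : ∃ l : ℝ, 0 ≤ l ∧ l ≤ 1 ∧ l * h₁ + (1 - l) * q ≤ hS ∧ l * t₁ + (1 - l) * q ≤ tS)
    (H₂ : ∃ l : ℝ, 0 ≤ l ∧ l ≤ 1 ∧ l * h₂ + (1 - l) * q ≤ h₁ ∧ l * t₂ + (1 - l) * q ≤ t₁) :
    ∃ l : ℝ, 0 ≤ l ∧ l ≤ 1 ∧ l * h₂ + (1 - l) * q ≤ hS ∧ l * t₂ + (1 - l) * q ≤ tS := by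
  obtain ⟨l₁, h10, h11, hh1, ht1⟩ := H₁
  obtain ⟨l₂, h20, h21, hh2, ht2⟩ := H₂
  refine ⟨l₁ * l₂, mul_nonneg h10 h20, by nlinarith, ?_, ?_⟩
  · have e1 : l₁ * (l₂ * h₂ + (1 - l₂) * q) ≤ l₁ * h₁ := mul_le_mul_of_nonneg_left hh2 h10
    have e2 : l₁ * l₂ * h₂ + (1 - l₁ * l₂) * q = l₁ * (l₂ * h₂ + (1 - l₂) * q) + (1 - l₁) * q := by ring
    linarith
  · have e1 : l₁ * (l₂ * t₂ + (1 - l₂) * q) ≤ l₁ * t₁ := mul_le_mul_of_nonneg_left ht2 h10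
    have e2 : l₁ * l₂ * t₂ + (1 - l₁ * l₂) * q = l₁ * (l₂ * t₂ + (1 - l₂) * q) + (1 - l₁) * q := by ring
    linarith

/-- **Exit** (`λ = 0`): if `q ≤ h_S` and `q ≤ t_S` then `S` dominates a mixture of any `S'` and `Q`. [this work] -/
theorem dominates_of_exit (q hS tS hP tP : ℝ) (hh : q ≤ hS) (ht : q ≤ tS) :
    ∃ l : ℝ, 0 ≤ l ∧ l ≤ 1 ∧ l * hP + (1 - l) * q ≤ hS ∧ l * tP + (1 - l) * q ≤ tS :=
  ⟨0, le_refl _, zero_le_one, by linarith, by linarith⟩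

/-- **Componentwise comparison** (`λ = 1`): if `h' ≤ h_S` and `t' ≤ t_S` then `S` dominates a mixture of `S'` and any `Q`. [this work] -/
theorem dominates_of_le (q hS tS hP tP : ℝ) (hh : hP ≤ hS) (ht : tP ≤ tS) :
    ∃ l : ℝ, 0 ≤ l ∧ l ≤ 1 ∧ l * hP + (1 - l) * q ≤ hS ∧ l * tP + (1 - l) * q ≤ tS :=
  ⟨1, zero_le_one, le_refl _, by linarith, by linarith⟩

/-- **Independent noise.**  Adding an independent count with law `(z₀, s₀, d₀)` on `{0, 1, ≥ 2}` (`z₀ + s₀ + d₀ = 1`, all `≥ 0`) to a block count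
`X` changes `(P(X ≥ 1), P(X ≥ 2)) = (h, t)` into `(z₀h + (1 − z₀), z₀t + s₀h + d₀)`.  If `S` dominates a mixture of `S'` and `Q = (q,q)` with
`q ≤ 1`, then the noisy `S` dominates a mixture of the noisy `S'` and the SAME `Q` (same `λ`; the image of `Q` lies above `Q`). [this work] -/
theorem dominates_noise (q hS tS hP tP z₀ s₀ d₀ : ℝ) (hz : 0 ≤ z₀) (hs : 0 ≤ s₀) (hd : 0 ≤ d₀) (hsum : z₀ + s₀ + d₀ = 1)
    (hq : q ≤ 1)
    (H : ∃ l : ℝ, 0 ≤ l ∧ l ≤ 1 ∧ l * hP + (1 - l) * q ≤ hS ∧ l * tP + (1 - l) * q ≤ tS) :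
    ∃ l : ℝ, 0 ≤ l ∧ l ≤ 1 ∧
      l * (z₀ * hP + (1 - z₀)) + (1 - l) * q ≤ z₀ * hS + (1 - z₀) ∧
      l * (z₀ * tP + s₀ * hP + d₀) + (1 - l) * q ≤ z₀ * tS + s₀ * hS + d₀ := by
  obtain ⟨l, hl0, hl1, hh, ht⟩ := H
  refine ⟨l, hl0, hl1, ?_, ?_⟩
  · -- `RHS − LHS = z₀·(h_S − (λh' + (1−λ)q)) + (1−λ)(1−z₀)(1 − q) ≥ 0`
    have e1 : 0 ≤ z₀ * (hS - (l * hP + (1 - l) * q)) := mul_nonneg hz (by linarith)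
    have e2 : 0 ≤ (1 - l) * (1 - z₀) * (1 - q) := by
      have : 0 ≤ 1 - z₀ := by linarith
      exact mul_nonneg (mul_nonneg (by linarith) this) (by linarith)
    have key : z₀ * hS + (1 - z₀) - (l * (z₀ * hP + (1 - z₀)) + (1 - l) * q) =
        z₀ * (hS - (l * hP + (1 - l) * q)) + (1 - l) * (1 - z₀) * (1 - q) := by ring
    linarith
  · -- `RHS − LHS = z₀·(t_S − (λt' + (1−λ)q)) + s₀·(h_S − (λh' + (1−λ)q)) + (1−λ)d₀(1 − q) ≥ 0` (using `z₀ + s₀ + d₀ = 1`)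
    have e1 : 0 ≤ z₀ * (tS - (l * tP + (1 - l) * q)) := mul_nonneg hz (by linarith)
    have e2 : 0 ≤ s₀ * (hS - (l * hP + (1 - l) * q)) := mul_nonneg hs (by linarith)
    have e3 : 0 ≤ (1 - l) * d₀ * (1 - q) := mul_nonneg (mul_nonneg (by linarith) hd) (by linarith)
    have key : z₀ * tS + s₀ * hS + d₀ - (l * (z₀ * tP + s₀ * hP + d₀) + (1 - l) * q) =
        z₀ * (tS - (l * tP + (1 - l) * q)) + s₀ * (hS - (l * hP + (1 - l) * q)) + (1 - l) * d₀ * (1 - q) -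
          (1 - l) * q * (1 - (z₀ + s₀ + d₀)) := by ring
    rw [hsum, sub_self, mul_zero, sub_zero] at key
    linarith

/-- **The first-coordinate-tight criterion.**  If `q ≤ h_S ≤ h'`, `q < h'` and
`F := (t_S − t')(h' − q) − (h' − h_S)(q − t') ≥ 0`, then `S` dominates a mixture of `S'` and `Q = (q,q)`: with `λ = (h_S − q)/(h' − q)` the
first coordinate is an equality and the second is `F ≥ 0`, by the identity `F = (t_S − q)(h' − q) + (h_S − q)(q − t')`. [this work] -/
theorem dominates_of_tight (q hS tS hP tP : ℝ) (hq : q ≤ hS) (hSP : hS ≤ hP) (hqP : q < hP)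
    (hF : 0 ≤ (tS - tP) * (hP - q) - (hP - hS) * (q - tP)) :
    ∃ l : ℝ, 0 ≤ l ∧ l ≤ 1 ∧ l * hP + (1 - l) * q ≤ hS ∧ l * tP + (1 - l) * q ≤ tS := by
  have hgap : 0 < hP - q := by linarith
  set l := (hS - q) / (hP - q) with hl
  have hl0 : 0 ≤ l := div_nonneg (by linarith) hgap.le
  have hl1 : l ≤ 1 := by rw [hl, div_le_one hgap]; linarith
  have hlgap : l * (hP - q) = hS - q := div_mul_cancel₀ _ (ne_of_gt hgap)
  refine ⟨l, hl0, hl1, ?_, ?_⟩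
  · have : l * hP + (1 - l) * q = q + l * (hP - q) := by ring
    rw [this, hlgap]; linarith
  · -- `λ(t' − q) ≤ t_S − q`: multiply by `h' − q > 0` and use `F = (t_S − q)(h' − q) + (h_S − q)(q − t')`
    have hid : (tS - tP) * (hP - q) - (hP - hS) * (q - tP) = (tS - q) * (hP - q) + (hS - q) * (q - tP) := by ring
    have h1 : l * (tP - q) * (hP - q) = (hS - q) * (tP - q) := by
      calc l * (tP - q) * (hP - q) = l * (hP - q) * (tP - q) := by ring
        _ = (hS - q) * (tP - q) := by rw [hlgap]
    have h2 : l * (tP - q) * (hP - q) ≤ (tS - q) * (hP - q) := by rw [h1]; linarith [hid]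
    have h3 : l * (tP - q) ≤ tS - q := le_of_mul_le_mul_right h2 hgap
    have : l * tP + (1 - l) * q = q + l * (tP - q) := by ring
    rw [this]; linarith

/-- **`F` is affine in `q`; reduction to `q = μ`.**  With `F(q) := (t_S − t')(h' − q) − (h' − h_S)(q − t')` one has `F(t_S) = (t_S − t')(h_S − t_S)`, so
if `D := t_S − t' ≥ 0`, `t_S ≤ h_S` and `F(μ) ≥ 0` then `F(q) ≥ 0` for every `q ∈ [t_S, μ]`.  (In the k-anchor programme: it suffices to prove the
decoupling inequality at the largest admissible exit point `μ = min_i m_i u_i`, together with `D ≥ 0`.) [this work] -/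
theorem tight_F_affine (hS tS hP tP μ q : ℝ) (hD : 0 ≤ tS - tP) (hth : tS ≤ hS)
    (hFμ : 0 ≤ (tS - tP) * (hP - μ) - (hP - hS) * (μ - tP)) (hq1 : tS ≤ q) (hq2 : q ≤ μ) :
    0 ≤ (tS - tP) * (hP - q) - (hP - hS) * (q - tP) := by
  -- value at `q = t_S`
  have hFt : (tS - tP) * (hP - tS) - (hP - hS) * (tS - tP) = (tS - tP) * (hS - tS) := by ring
  have hFt0 : 0 ≤ (tS - tP) * (hP - tS) - (hP - hS) * (tS - tP) := by rw [hFt]; exact mul_nonneg hD (by linarith)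
  rcases eq_or_lt_of_le (le_trans hq1 hq2) with heq | hlt
  · -- `t_S = μ`, hence `q = μ`
    have : q = μ := le_antisymm hq2 (heq ▸ hq1)
    rw [this]; exact hFμ
  · -- affine interpolation between `t_S` and `μ`
    have hid : ((tS - tP) * (hP - q) - (hP - hS) * (q - tP)) * (μ - tS) =
        (μ - q) * ((tS - tP) * (hP - tS) - (hP - hS) * (tS - tP)) +
          (q - tS) * ((tS - tP) * (hP - μ) - (hP - hS) * (μ - tP)) := by ring
    have hpos : 0 < μ - tS := by linarith
    have hrhs : 0 ≤ (μ - q) * ((tS - tP) * (hP - tS) - (hP - hS) * (tS - tP)) +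
        (q - tS) * ((tS - tP) * (hP - μ) - (hP - hS) * (μ - tP)) :=
      add_nonneg (mul_nonneg (by linarith) hFt0) (mul_nonneg (by linarith) hFμ)
    by_contra hneg
    have hneg' : (tS - tP) * (hP - q) - (hP - hS) * (q - tP) < 0 := not_le.mp hneg
    have : ((tS - tP) * (hP - q) - (hP - hS) * (q - tP)) * (μ - tS) < 0 := mul_neg_of_neg_of_pos hneg' hpos
    linarith [hid]

end Block

end Quant

end Summit.CriticalPhenomena.PercolationContinuityZ3.Theorems
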